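import Summits.QuantumFields.BalabanUV.Beta.D1BFx.PairingByParts
import Summits.QuantumFields.BalabanUV.Beta.D1BFx.LatticeHLS

/-!
# `BalabanUV.Beta.D1BFx.NeedleDipPairings` — road «BF-x» for binder row D1, slot (K), END row `hGrp gN`, «KK-PAIRINGS»: THE PAIRING TYPES `⟨∇G_u, A∇F_v⟩` OF THE
# DIPOLE CELLS FROM ABSTRACT LETTERS — flat × flat, flat × Coulomb, flat × dipole (by parts in the leg), Coulomb × flat, dipole × flat (by parts at the
# pairing), Coulomb × Coulomb (the critical `(3,1)` sum, LOG-FREE: `≤ C·(1 + (1∕ε)∕nrm(u−v))`), Coulomb × dipole and dipole × Coulomb (`∕nrm(u−v)`)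

HONEST DEPENDENCY (cell records, verbatim): «continuum YM on T⁴ ⇐ BetaPertH ∧ nine spine estimates (0/9 proved); BetaPertH ⇐ (D1) ∧ (D4) ∧
CAP+tail; G-an2-4 gates asym, D1 and NE2/3/4.»  HONEST FRAMING (cell contract, verbatim): «discharging `BetaPertH` makes Bałaban's UV stability
UNCONDITIONAL — a real constructive-QFT result; it is NOT the continuum limit and NOT the Clay problem.»  THIS MODULE DISCHARGES NOTHING of the
wall: [folklore] lattice bookkeeping over leaf-04-g9's HLS kit (`LatticeHLS`, `LatticeHLSProfiles`, `LatticeHLSDamped`, `PairingByParts`) in the owner's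
rank-one frame (`RankOneBubble.pairing ∕ applyK`, `RankOneBubbleJets.grad`).  ABSTRACT leg `A` and functions: every letter is a HYPOTHESIS; nothing of the
tree's `Ga`, `RG`, `Pgt` is used here.  No `def`, no `def … : Prop`, nothing cited, 0 sorry.  Root-level binders hW ∕ hR-sockets ∕ hSX-socket ∕ D1Tel ∕
D1Rep — 0 discharged; (K) NOT closed; NOT D1, NOT `BetaPertH`, NOT continuum, NOT Clay.

WHY (cell «GN-33∕KK», leaf-04-g9 16-term ledger, journal 2026-08-21T11:16Z): after `NeedleDipShape.bubble_dip_dSw` ∕ `bubble_dip_expand_right` the KK word is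
sixteen products of two pairings `⟨∇G_u, Ga∇F_v⟩`, `G, F ∈ {p, δp, ρ, δρ}`; `p, δp` have FLAT damped gradient letters (`n⁻⁵`, `n⁻⁶`), `ρ` a Coulomb gradient
letter (`kP n⁻²·e∕nrm³`), `δρ` only the dipole letter (`kD n⁻²·e∕nrm³`) — its gradient is moved onto the leg by parts.  This file bounds every pairing
type but `(δρ, δρ)` (which needs the leg's Ward locality, see the row file) from such letters, keeping the partner decay `e^{−(ε∕4)‖u−v‖}` where the
budget needs it and the Coulomb factor `1∕nrm(u−v)` where it does not.

CONTENT (`D = 4`, fibre `Fin 4`; rate `ε > 0` common to all letters; `𝕂ₐ(ε) = 1 + 216·((3−a)!·(2∕(ε∕2))^{3−a}·(1+2∕(ε∕2)))` the kit's damped-flat constant,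
`C₄ = 373248 = 4·2⁷·9³` its HLS constant).
* §0 [folklore] `summable_mul_of_damped_flat`, **`sum_crit31_le`** (`Σ e^{−ε‖x−v‖}∕(nrm(x−u)³·nrm(x−v)) ≤ 5859 + 4(1+216(1+2∕ε))∕nrm(u−v)`, near∕far split —
  the critical `(3,1)` sum WITHOUT a logarithm, affordable because `1∕ε ≍ n` meets `1∕nrm(w)`), `kitConst_le` (`𝕂ₐ(ε₀∕n) ≤ 217(3−a)!(4∕ε₀)^{3−a}(1+4∕ε₀)·n^{4−a}`).
* §1 [folklore] the flat-partner types **`abs_pairing_flat_flat_le`**, **`abs_pairing_flat_coul_le`**, **`abs_pairing_flat_dip_le`**, **`abs_pairing_coul_flat_le`**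
  (all `≲ e^{−(ε∕4)‖u−v‖}`).
PART 2 (`NeedleDipPairingsCoul`): `abs_pairing_dip_flat_le` (by parts at the pairing) and the Coulomb × Coulomb types `abs_pairing_coul_coul_le` (`(3,1)` log-free),
`abs_pairing_coul_dip_le`, `abs_pairing_dip_coul_le` (`∕nrm(u−v)`).
Unit `b2b-balaban-beta-d1-formalise-leaf-04` (gen 9); `LEAVES-BFx.md` row (N) «KK-PAIRINGS».
-/

noncomputable section

namespace Summit.QuantumFields.BalabanUV.Beta.D1BFx.NeedleDipPairings

open Finset
open scoped BigOperators
open Literature.MathematicalPhysics.QuantumFieldTheory.Balaban1983to89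
open Literature.MathematicalPhysics.QuantumFieldTheory.Balaban1983to89.Beta
open ExpKernelCalculus (Site MKer)
open AffineAveraging (unitVec)
open PoissonInterior (nrm nrm_pos one_le_nrm nrm_neg supNorm supNorm_neg supNorm_le_nrm)
open Summit.QuantumFields.BalabanUV.Beta.D1BFx.RankOneBubble (applyK pairing pairing_def pairing_comm)
open Summit.QuantumFields.BalabanUV.Beta.D1BFx.RankOneBubbleJets (grad grad_apply)
open Summit.QuantumFields.BalabanUV.Beta.D1BFx.LatticeHLSRadial (nrm_eq_max)
open Summit.QuantumFields.BalabanUV.Beta.D1BFx.LatticeHLS (sum_near_le half_le_supNorm_of_far)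
open Summit.QuantumFields.BalabanUV.Beta.D1BFx.LatticeHLSProfiles (summable_and_abs_tsum_le_of_abs_sum_le sum_exp_div_nrm_pow_free_le)
open Summit.QuantumFields.BalabanUV.Beta.D1BFx.LatticeHLSPairing (abs_sum_fibre_mul_le)
open Summit.QuantumFields.BalabanUV.Beta.D1BFx.LatticeHLSDamped (abs_sum_mul_le_of_damped_profiles abs_applyK_le_of_damped_profiles
  abs_pairing_le_of_damped_profiles abs_sum_mul_le_of_damped_flat abs_applyK_le_of_damped_flat abs_pairing_le_of_damped_flat)
open Summit.QuantumFields.BalabanUV.Beta.D1BFx.PairingByParts (applyK_grad_eq pairing_grad_eq applyK_shift_sub abs_applyK_grad_le_of_damped_profiles)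

/-! ## §0 Summability from letters, the log-free critical sum, the scale of the kit constants -/

/-- [folklore] a damped Coulomb letter (`a ≤ 3`) times a flat damped letter is summable. -/
theorem summable_mul_of_damped_flat {a : ℕ} (ha : a ≤ 3) {K f : Site 4 → ℝ} {κ B ε : ℝ} (hκ : 0 ≤ κ) (hB : 0 ≤ B) (hε : 0 < ε) (u v : Site 4)
    (hK : ∀ x, |K x| ≤ κ * Real.exp (-ε * supNorm (x - u)) / nrm (x - u) ^ a) (hf : ∀ x, |f x| ≤ B * Real.exp (-ε * supNorm (x - v))) :
    Summable fun x => K x * f x :=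
  (summable_and_abs_tsum_le_of_abs_sum_le fun S =>
    abs_sum_mul_le_of_damped_flat (d := 4) (by norm_num) (by omega) hκ hB hε S u v (fun x _ => hK x) (fun x _ => hf x)).1

/-- [folklore] a damped Coulomb letter times a damped Coulomb letter at super-critical total exponent (`a, b ≤ 3`, `a + b ≥ 5`) is summable. -/
theorem summable_mul_of_damped_profiles {a b : ℕ} (ha : a ≤ 3) (hb : b ≤ 3) (hab : 5 ≤ a + b) {K f : Site 4 → ℝ} {κ B ε : ℝ} (hκ : 0 ≤ κ)
    (hB : 0 ≤ B) (hε : 0 ≤ ε) (u v : Site 4)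
    (hK : ∀ x, |K x| ≤ κ * Real.exp (-ε * supNorm (x - u)) / nrm (x - u) ^ a) (hf : ∀ x, |f x| ≤ B * Real.exp (-ε * supNorm (x - v)) / nrm (x - v) ^ b) :
    Summable fun x => K x * f x :=
  (LatticeHLSDamped.abs_tsum_mul_le_of_damped_profiles (d := 4) (by norm_num) (by omega) (by omega) (by omega) hκ hB hε u v hK hf).1

/-- [folklore] **THE CRITICAL `(3,1)` SUM, LOG-FREE**: `Σ_{x∈S} e^{−ε‖x−v‖}∕(nrm(x−u)³·nrm(x−v)) ≤ 5859 + 4·(1 + 216·(1 + 2∕ε))∕nrm(u−v)` — near `v` (`2‖x−v‖ ≤ ‖u−v‖`)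
the window lemma `sum_near_le` gives `27·217`; far from `v` one has `nrm(x−v) ≥ nrm(u−v)∕2` and the damping-centre-free lemma at `p = 3` gives `2(1+216(1+2∕ε))`.
(With `ε ≍ 1∕n` this is `C(1 + n∕nrm(u−v))`: the logarithm of the sharp bound is traded for a power the cell's budget affords.) -/
theorem sum_crit31_le {ε : ℝ} (hε : 0 < ε) (S : Finset (Site 4)) (u v : Site 4) :
    ∑ x ∈ S, Real.exp (-ε * supNorm (x - v)) / (nrm (x - u) ^ 3 * nrm (x - v)) ≤ 5859 + 4 * (1 + 216 * (1 + 2 / ε)) / nrm (u - v) := by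
  classical
  set Sn := S.filter (fun x => 2 * supNorm (x - v) ≤ supNorm (v - u)) with hSn
  set Sf := S.filter (fun x => ¬ 2 * supNorm (x - v) ≤ supNorm (v - u)) with hSf
  have hsplit := (Finset.sum_filter_add_sum_filter_not S (fun x => 2 * supNorm (x - v) ≤ supNorm (v - u))
    (fun x => Real.exp (-ε * supNorm (x - v)) / (nrm (x - u) ^ 3 * nrm (x - v)))).symm
  rw [hsplit]
  have hnuv := nrm_pos (d := 4) (u - v)
  -- near `v`
  have hnear : ∑ x ∈ Sn, Real.exp (-ε * supNorm (x - v)) / (nrm (x - u) ^ 3 * nrm (x - v)) ≤ 5859 := by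
    have h1 := sum_near_le (d := 4) (by norm_num) (a := 1) (by norm_num) 3 Sn v u (fun x hx => (Finset.mem_filter.mp hx).2)
    have hR : (0 : ℝ) < (supNorm (v - u) : ℝ) + 1 := by positivity
    have e1 : (3 : ℝ) ^ 3 * (1 + 2 * ((4 : ℕ) : ℝ) * 3 ^ (4 - 1)) * ((supNorm (v - u) : ℝ) + 1) ^ (4 - 1) / ((supNorm (v - u) : ℝ) + 1) ^ 3
        = 5859 := by
      rw [show (4 : ℕ) - 1 = 3 from rfl, mul_div_assoc, div_self (pow_pos hR 3).ne', mul_one]; norm_num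
    rw [e1] at h1
    refine le_trans (Finset.sum_le_sum fun x _ => ?_) h1
    have hxu := pow_pos (nrm_pos (d := 4) (x - u)) 3
    have hxv := nrm_pos (d := 4) (x - v)
    rw [pow_one, mul_comm (nrm (x - v)) _, div_le_div_iff₀ (by positivity) (by positivity), one_mul]
    have hexp : Real.exp (-ε * supNorm (x - v)) ≤ 1 := by
      rw [Real.exp_le_one_iff]; have : (0 : ℝ) ≤ ε * supNorm (x - v) := by positivity
      linarith
    calc Real.exp (-ε * supNorm (x - v)) * (nrm (x - u) ^ 3 * nrm (x - v)) ≤ 1 * (nrm (x - u) ^ 3 * nrm (x - v)) :=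
          mul_le_mul_of_nonneg_right hexp (by positivity)
      _ = nrm (x - u) ^ 3 * nrm (x - v) := one_mul _
  -- far from `v`
  have hfar : ∑ x ∈ Sf, Real.exp (-ε * supNorm (x - v)) / (nrm (x - u) ^ 3 * nrm (x - v)) ≤ 4 * (1 + 216 * (1 + 2 / ε)) / nrm (u - v) := by
    have h2 := sum_exp_div_nrm_pow_free_le (d := 4) (by norm_num) hε (p := 3) (by norm_num) Sf u v
    have e2 : (2 : ℝ) * (1 + 2 * ((4 : ℕ) : ℝ) * 3 ^ (4 - 1) * (((4 - 1 - 3).factorial : ℝ) * (2 / ε) ^ (4 - 1 - 3) * (1 + 2 / ε)))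
        = 2 * (1 + 216 * (1 + 2 / ε)) := by norm_num [Nat.factorial]
    rw [e2] at h2
    have hpt : ∀ x ∈ Sf, Real.exp (-ε * supNorm (x - v)) / (nrm (x - u) ^ 3 * nrm (x - v))
        ≤ 2 / nrm (u - v) * (Real.exp (-ε * supNorm (x - v)) / nrm (x - u) ^ 3) := by
      intro x hx
      have hfx : supNorm (v - u) < 2 * supNorm (x - v) := not_le.mp (Finset.mem_filter.mp hx).2
      rw [← neg_sub u v, supNorm_neg] at hfx
      have hh := half_le_supNorm_of_far (d := 4) hfx
      have hh' : supNorm (u - v) + 1 ≤ 2 * supNorm (x - v) := by omega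
      have hr : (supNorm (u - v) : ℝ) + 1 ≤ 2 * (supNorm (x - v) : ℝ) := by exact_mod_cast hh'
      have hxv := nrm_pos (d := 4) (x - v)
      have hxu := pow_pos (nrm_pos (d := 4) (x - u)) 3
      have hnle : nrm (u - v) ≤ 2 * nrm (x - v) := by
        have h3 : nrm (u - v) ≤ (supNorm (u - v) : ℝ) + 1 := by
          rw [nrm_eq_max]; exact max_le (by linarith [Nat.cast_nonneg (α := ℝ) (supNorm (u - v))]) (by linarith)
        linarith [supNorm_le_nrm (d := 4) (x - v)]
      rw [div_mul_div_comm, div_le_div_iff₀ (by positivity) (by positivity)]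
      calc Real.exp (-ε * supNorm (x - v)) * (nrm (u - v) * nrm (x - u) ^ 3)
          ≤ Real.exp (-ε * supNorm (x - v)) * (2 * nrm (x - v) * nrm (x - u) ^ 3) := by gcongr
        _ = 2 * Real.exp (-ε * supNorm (x - v)) * (nrm (x - u) ^ 3 * nrm (x - v)) := by ring
    calc ∑ x ∈ Sf, Real.exp (-ε * supNorm (x - v)) / (nrm (x - u) ^ 3 * nrm (x - v))
        ≤ ∑ x ∈ Sf, 2 / nrm (u - v) * (Real.exp (-ε * supNorm (x - v)) / nrm (x - u) ^ 3) := Finset.sum_le_sum hpt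
      _ = 2 / nrm (u - v) * ∑ x ∈ Sf, Real.exp (-ε * supNorm (x - v)) / nrm (x - u) ^ 3 := by rw [Finset.mul_sum]
      _ ≤ 2 / nrm (u - v) * (2 * (1 + 216 * (1 + 2 / ε))) := mul_le_mul_of_nonneg_left h2 (by positivity)
      _ = 4 * (1 + 216 * (1 + 2 / ε)) / nrm (u - v) := by field_simp; ring
  linarith

/-- [folklore] **THE SCALE OF THE KIT CONSTANTS**: at rate `ε₀∕n` (`0 < ε₀ ≤ 1`, `n ≥ 1`), `𝕂ₐ(ε₀∕n) ≤ 217·(3−a)!·(4∕ε₀)^{3−a}·(1 + 4∕ε₀)·n^{4−a}` for `a ≤ 3`. -/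
theorem kitConst_le {a : ℕ} (ha : a ≤ 3) {ε₀ : ℝ} (hε₀ : 0 < ε₀) (hε₁ : ε₀ ≤ 1) {n : ℕ} (hn : 1 ≤ n) :
    (1 + 2 * ((4 : ℕ) : ℝ) * 3 ^ (4 - 1) * (((4 - 1 - a).factorial : ℝ) * (2 / (ε₀ / n / 2)) ^ (4 - 1 - a) * (1 + 2 / (ε₀ / n / 2))))
      ≤ 217 * ((3 - a).factorial * (4 / ε₀) ^ (3 - a) * (1 + 4 / ε₀)) * (n : ℝ) ^ (4 - a) := by
  have hn1 : (1 : ℝ) ≤ n := by exact_mod_cast hn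
  have hn0 : (0 : ℝ) < n := by linarith
  have e1 : (2 : ℝ) / (ε₀ / n / 2) = 4 / ε₀ * n := by field_simp; ring
  have e3 : (4 : ℕ) - 1 - a = 3 - a := by omega
  rw [e1, e3, show (4 : ℕ) - 1 = 3 from rfl]
  have hq : (1 : ℝ) ≤ 4 / ε₀ := by rw [le_div_iff₀ hε₀]; linarith
  have hf1 : (1 : ℝ) ≤ ((3 - a).factorial : ℝ) := by exact_mod_cast Nat.succ_le_of_lt (Nat.factorial_pos _)
  have hp1 : (1 : ℝ) ≤ (4 / ε₀) ^ (3 - a) := one_le_pow₀ hq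
  have hr1 : (1 : ℝ) ≤ 1 + 4 / ε₀ := by linarith [div_pos (by norm_num : (0:ℝ) < 4) hε₀]
  have hnp : (1 : ℝ) ≤ (n : ℝ) ^ (4 - a) := one_le_pow₀ hn1
  -- the main term
  have hmain : ((3 - a).factorial : ℝ) * (4 / ε₀ * n) ^ (3 - a) * (1 + 4 / ε₀ * n)
      ≤ ((3 - a).factorial * (4 / ε₀) ^ (3 - a) * (1 + 4 / ε₀)) * (n : ℝ) ^ (4 - a) := by
    have h1 : (1 : ℝ) + 4 / ε₀ * n ≤ (1 + 4 / ε₀) * n := by nlinarith [div_pos (by norm_num : (0:ℝ) < 4) hε₀]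
    have e4 : (n : ℝ) ^ (4 - a) = (n : ℝ) ^ (3 - a) * n := by rw [← pow_succ]; congr 1; omega
    rw [mul_pow, e4]
    calc ((3 - a).factorial : ℝ) * ((4 / ε₀) ^ (3 - a) * (n : ℝ) ^ (3 - a)) * (1 + 4 / ε₀ * n)
        ≤ ((3 - a).factorial : ℝ) * ((4 / ε₀) ^ (3 - a) * (n : ℝ) ^ (3 - a)) * ((1 + 4 / ε₀) * n) :=
          mul_le_mul_of_nonneg_left h1 (by positivity)
      _ = _ := by ring
  -- `1 ≤ the product` absorbs the leading `1`
  have hone : (1 : ℝ) ≤ ((3 - a).factorial * (4 / ε₀) ^ (3 - a) * (1 + 4 / ε₀)) * (n : ℝ) ^ (4 - a) := by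
    have := one_le_mul_of_one_le_of_one_le (one_le_mul_of_one_le_of_one_le (one_le_mul_of_one_le_of_one_le hf1 hp1) hr1) hnp
    exact this
  norm_num
  nlinarith

/-! ## §1 The flat-partner pairing types -/

section Pairings

variable {A : MKer 4 (Fin 4)} {G F : Site 4 → ℝ} {kA kA' kA₁ BG BF ε : ℝ} (u v : Site 4)

/-- [folklore] **FLAT × FLAT**: `|∇G| ≤ BG·e^{−ε‖·−u‖}`, `|∇F| ≤ BF·e^{−ε‖·−v‖}`, `|A| ≤ kA·e∕nrm²` ⇒
`|⟨∇G, A∇F⟩| ≤ 4·BG·(4·kA·BF·𝕂₂(ε))·e^{−(ε∕4)‖u−v‖}·𝕂₀(ε∕2)` (flat in ⇒ flat out at rate `ε∕2`, then flat × flat). -/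
theorem abs_pairing_flat_flat_le (hkA : 0 ≤ kA) (hBG : 0 ≤ BG) (hBF : 0 ≤ BF) (hε : 0 < ε)
    (hA0 : ∀ (x y : Site 4) (c b : Fin 4), |A x y c b| ≤ kA * Real.exp (-ε * supNorm (x - y)) / nrm (x - y) ^ 2)
    (hG : ∀ (x : Site 4) (a : Fin 4), |grad G x a| ≤ BG * Real.exp (-ε * supNorm (x - u)))
    (hF : ∀ (y : Site 4) (b : Fin 4), |grad F y b| ≤ BF * Real.exp (-ε * supNorm (y - v))) :
    |pairing (grad G) (applyK A (grad F))| ≤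
      4 * BG * (4 * kA * BF * (1 + 2 * ((4 : ℕ) : ℝ) * 3 ^ (4 - 1) * ((Nat.factorial (4 - 1 - 2) : ℝ) * (2 / (ε / 2)) ^ (4 - 1 - 2) * (1 + 2 / (ε / 2))))) * Real.exp (-(ε / 2 / 2) * supNorm (u - v)) * (1 + 2 * ((4 : ℕ) : ℝ) * 3 ^ (4 - 1) * ((Nat.factorial (4 - 1 - 0) : ℝ) * (2 / ((ε / 2) / 2)) ^ (4 - 1 - 0) * (1 + 2 / ((ε / 2) / 2)))) := by
  have hAF : ∀ (x : Site 4) (c : Fin 4), |applyK A (grad F) x c| ≤ (4 * kA * BF * (1 + 2 * ((4 : ℕ) : ℝ) * 3 ^ (4 - 1) * ((Nat.factorial (4 - 1 - 2) : ℝ) * (2 / (ε / 2)) ^ (4 - 1 - 2) * (1 + 2 / (ε / 2))))) * Real.exp (-(ε / 2) * supNorm (x - v)) := by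
    intro x c
    have h := abs_applyK_le_of_damped_flat (d := 4) (F := Fin 4) (by norm_num) (a := 2) (by norm_num) hkA hBF hε v hA0 hF x c
    simp only [Fintype.card_fin] at h
    refine h.trans (le_of_eq ?_); push_cast; ring
  have hG' : ∀ (x : Site 4) (a : Fin 4), |grad G x a| ≤ BG * Real.exp (-(ε / 2) * supNorm (x - u)) / nrm (x - u) ^ 0 := fun x a => by
    rw [pow_zero, div_one]
    refine (hG x a).trans (mul_le_mul_of_nonneg_left (Real.exp_le_exp.2 ?_) hBG)
    have : (0 : ℝ) ≤ ε * supNorm (x - u) := by positivity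
    nlinarith
  have hK : 0 ≤ 4 * kA * BF * (1 + 2 * ((4 : ℕ) : ℝ) * 3 ^ (4 - 1) * ((Nat.factorial (4 - 1 - 2) : ℝ) * (2 / (ε / 2)) ^ (4 - 1 - 2) * (1 + 2 / (ε / 2)))) := by positivity
  have h := abs_pairing_le_of_damped_flat (d := 4) (F := Fin 4) (by norm_num) (a := 0) (by norm_num) hBG hK (half_pos hε) u v hG' hAF
  simp only [Fintype.card_fin] at h
  refine h.2.trans (le_of_eq ?_); push_cast; ring

/-- [folklore] **FLAT × COULOMB**: `|∇G| ≤ BG·e^{−ε‖·−u‖}` flat, `|∇F| ≤ BF·e^{−ε‖·−v‖}∕nrm³` ⇒ `|⟨∇G, A∇F⟩| ≤ 4·(4·kA·BF·C₄)·BG·e^{−(ε∕2)‖v−u‖}·𝕂₁(ε)`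
(profiles `(2,3) ↦ 1` in the leg, then Coulomb-1 × flat). -/
theorem abs_pairing_flat_coul_le (hkA : 0 ≤ kA) (hBG : 0 ≤ BG) (hBF : 0 ≤ BF) (hε : 0 < ε)
    (hA0 : ∀ (x y : Site 4) (c b : Fin 4), |A x y c b| ≤ kA * Real.exp (-ε * supNorm (x - y)) / nrm (x - y) ^ 2)
    (hG : ∀ (x : Site 4) (a : Fin 4), |grad G x a| ≤ BG * Real.exp (-ε * supNorm (x - u)))
    (hF : ∀ (y : Site 4) (b : Fin 4), |grad F y b| ≤ BF * Real.exp (-ε * supNorm (y - v)) / nrm (y - v) ^ 3) :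
    |pairing (grad G) (applyK A (grad F))| ≤ 4 * (4 * kA * BF * 373248) * BG * Real.exp (-(ε / 2) * supNorm (v - u)) * (1 + 2 * ((4 : ℕ) : ℝ) * 3 ^ (4 - 1) * ((Nat.factorial (4 - 1 - 1) : ℝ) * (2 / (ε / 2)) ^ (4 - 1 - 1) * (1 + 2 / (ε / 2)))) := by
  have hAF : ∀ (x : Site 4) (c : Fin 4), |applyK A (grad F) x c| ≤ (4 * kA * BF * 373248) * Real.exp (-ε * supNorm (x - v)) / nrm (x - v) ^ 1 := by
    intro x c
    have h := abs_applyK_le_of_damped_profiles (d := 4) (F := Fin 4) (by norm_num) (a := 2) (b := 3) (by norm_num) (by norm_num) (by norm_num)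
      hkA hBF hε.le v hA0 hF x c
    simp only [Fintype.card_fin] at h
    norm_num at h ⊢
    exact h
  have hK : 0 ≤ 4 * kA * BF * 373248 := by positivity
  rw [pairing_comm]
  have h := abs_pairing_le_of_damped_flat (d := 4) (F := Fin 4) (by norm_num) (a := 1) (by norm_num) hK hBG hε v u hAF hG
  simp only [Fintype.card_fin] at h
  refine h.2.trans (le_of_eq ?_); push_cast; ring

/-- [folklore] **FLAT × DIPOLE (by parts in the leg)**: `|∇G| ≤ BG·e` flat at `u`, the site dipole letter `|F| ≤ BF·e∕nrm(·−v)³`, the leg's entry letters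
`kA` (and shifted `kA′`) and backward second-site d1 letter `kA₁e∕nrm³` ⇒ `|⟨∇G, A∇F⟩| ≤ 4·(4·kA₁·BF·C₄)·BG·e^{−(ε∕2)‖v−u‖}·𝕂₂(ε)`. -/
theorem abs_pairing_flat_dip_le (hkA : 0 ≤ kA) (hkA' : 0 ≤ kA') (hkA₁ : 0 ≤ kA₁) (hBG : 0 ≤ BG) (hBF : 0 ≤ BF) (hε : 0 < ε)
    (hA0 : ∀ (x y : Site 4) (c b : Fin 4), |A x y c b| ≤ kA * Real.exp (-ε * supNorm (x - y)) / nrm (x - y) ^ 2)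
    (hA0r : ∀ (x y : Site 4) (c b : Fin 4), |A x (y - unitVec b) c b| ≤ kA' * Real.exp (-ε * supNorm (x - y)) / nrm (x - y) ^ 2)
    (hA1r : ∀ (x y : Site 4) (c b : Fin 4), |A x (y - unitVec b) c b - A x y c b| ≤ kA₁ * Real.exp (-ε * supNorm (x - y)) / nrm (x - y) ^ 3)
    (hG : ∀ (x : Site 4) (a : Fin 4), |grad G x a| ≤ BG * Real.exp (-ε * supNorm (x - u)))
    (hF : ∀ y : Site 4, |F y| ≤ BF * Real.exp (-ε * supNorm (y - v)) / nrm (y - v) ^ 3) :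
    |pairing (grad G) (applyK A (grad F))| ≤ 4 * (4 * kA₁ * BF * 373248) * BG * Real.exp (-(ε / 2) * supNorm (v - u)) * (1 + 2 * ((4 : ℕ) : ℝ) * 3 ^ (4 - 1) * ((Nat.factorial (4 - 1 - 2) : ℝ) * (2 / (ε / 2)) ^ (4 - 1 - 2) * (1 + 2 / (ε / 2)))) := by
  have hAF : ∀ (x : Site 4) (c : Fin 4), |applyK A (grad F) x c| ≤ (4 * kA₁ * BF * 373248) * Real.exp (-ε * supNorm (x - v)) / nrm (x - v) ^ 2 := by
    intro x c
    have h := abs_applyK_grad_le_of_damped_profiles hkA hkA' hkA₁ hBF hε.le v hA0 hA0r hA1r hF x c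
    norm_num at h ⊢
    exact h
  have hK : 0 ≤ 4 * kA₁ * BF * 373248 := by positivity
  rw [pairing_comm]
  have h := abs_pairing_le_of_damped_flat (d := 4) (F := Fin 4) (by norm_num) (a := 2) (by norm_num) hK hBG hε v u hAF hG
  simp only [Fintype.card_fin] at h
  refine h.2.trans (le_of_eq ?_); push_cast; ring

/-- [folklore] **COULOMB × FLAT**: `|∇G| ≤ BG·e∕nrm(·−u)³`, `|∇F| ≤ BF·e` flat at `v` ⇒ `|⟨∇G, A∇F⟩| ≤ 4·BG·(4·kA·BF·𝕂₂(ε))·e^{−(ε∕4)‖u−v‖}·𝕂₃(ε∕2)`. -/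
theorem abs_pairing_coul_flat_le (hkA : 0 ≤ kA) (hBG : 0 ≤ BG) (hBF : 0 ≤ BF) (hε : 0 < ε)
    (hA0 : ∀ (x y : Site 4) (c b : Fin 4), |A x y c b| ≤ kA * Real.exp (-ε * supNorm (x - y)) / nrm (x - y) ^ 2)
    (hG : ∀ (x : Site 4) (a : Fin 4), |grad G x a| ≤ BG * Real.exp (-ε * supNorm (x - u)) / nrm (x - u) ^ 3)
    (hF : ∀ (y : Site 4) (b : Fin 4), |grad F y b| ≤ BF * Real.exp (-ε * supNorm (y - v))) :
    |pairing (grad G) (applyK A (grad F))| ≤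
      4 * BG * (4 * kA * BF * (1 + 2 * ((4 : ℕ) : ℝ) * 3 ^ (4 - 1) * ((Nat.factorial (4 - 1 - 2) : ℝ) * (2 / (ε / 2)) ^ (4 - 1 - 2) * (1 + 2 / (ε / 2))))) * Real.exp (-(ε / 2 / 2) * supNorm (u - v)) * (1 + 2 * ((4 : ℕ) : ℝ) * 3 ^ (4 - 1) * ((Nat.factorial (4 - 1 - 3) : ℝ) * (2 / ((ε / 2) / 2)) ^ (4 - 1 - 3) * (1 + 2 / ((ε / 2) / 2)))) := by
  have hAF : ∀ (x : Site 4) (c : Fin 4), |applyK A (grad F) x c| ≤ (4 * kA * BF * (1 + 2 * ((4 : ℕ) : ℝ) * 3 ^ (4 - 1) * ((Nat.factorial (4 - 1 - 2) : ℝ) * (2 / (ε / 2)) ^ (4 - 1 - 2) * (1 + 2 / (ε / 2))))) * Real.exp (-(ε / 2) * supNorm (x - v)) := by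
    intro x c
    have h := abs_applyK_le_of_damped_flat (d := 4) (F := Fin 4) (by norm_num) (a := 2) (by norm_num) hkA hBF hε v hA0 hF x c
    simp only [Fintype.card_fin] at h
    refine h.trans (le_of_eq ?_); push_cast; ring
  have hG' : ∀ (x : Site 4) (a : Fin 4), |grad G x a| ≤ BG * Real.exp (-(ε / 2) * supNorm (x - u)) / nrm (x - u) ^ 3 := fun x a => by
    refine (hG x a).trans (div_le_div_of_nonneg_right (mul_le_mul_of_nonneg_left (Real.exp_le_exp.2 ?_) hBG) (pow_pos (nrm_pos _) 3).le)
    have : (0 : ℝ) ≤ ε * supNorm (x - u) := by positivity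
    nlinarith
  have hK : 0 ≤ 4 * kA * BF * (1 + 2 * ((4 : ℕ) : ℝ) * 3 ^ (4 - 1) * ((Nat.factorial (4 - 1 - 2) : ℝ) * (2 / (ε / 2)) ^ (4 - 1 - 2) * (1 + 2 / (ε / 2)))) := by positivity
  have h := abs_pairing_le_of_damped_flat (d := 4) (F := Fin 4) (by norm_num) (a := 3) (by norm_num) hBG hK (half_pos hε) u v hG' hAF
  simp only [Fintype.card_fin] at h
  refine h.2.trans (le_of_eq ?_); push_cast; ring

end Pairings

end Summit.QuantumFields.BalabanUV.Beta.D1BFx.NeedleDipPairings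

end
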